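import Mathlib
import Summits.ValiantsHypothesis.ValiantsHypothesis.Theorems.RigidityForcesSymmetryRankRigidMinimalReprLaplaceFiveOnShellBasics

/-!
# ValiantsHypothesis / RigidityForcesSymmetry — crux `LaplaceOptimalFive` (stmt-ValiantsHypothesis-24813), line
`shallow_collision`, stub S1 `stub_onShell_five`: CANONICAL FORM of the on-shell fibers.

On-shell factors only see image sets, so there are functions `F t, G t : Finset (Fin 5) → ℂ` with
`u t v = F t ((S t).image v)` and `w t v = G t ((S t)ᶜ.image v)` (`exists_F`, `exists_G`).  For a word
`ω ∘ ρ` (`ω 0 = ω 1`, `ρ` a rearrangement of the slots) every fiber sum becomes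
`∑_{t ∈ T, S t = S₀} F t (Q_A.image ω) * G t (Q_B.image ω)` with CANONICAL letter-index sets `Q_A, Q_B`
(`1` collapsed to `0`), so that equal image sets give syntactically equal unknowns.  `regroup_canon` turns the
exactness sum at `ω ∘ ρ` into the sum of these canonical fibers over a list whose side conditions are
`decide`-checkable; `occupied_of_fiber_ne_zero` reads a term of `T` off a nonzero fiber.

Honest framing.  Bookkeeping only; nothing here proves S1, `LaplaceOptimalFive` (OPEN) or `VP ≠ VNP`.
No definitions, no `sorry`; Mathlib only.
-/

set_option linter.dupNamespace false

namespace Summit.ValiantsHypothesis.ValiantsHypothesis.Theorems.RigidityForcesSymmetryRankRigidMinimalRepr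

namespace LaplaceFiveOnShell

open Finset

variable {N : ℕ} (T : Finset (Fin N)) (S : Fin N → Finset (Fin 5)) (u w : Fin N → (Fin 5 → Fin 5) → ℂ)

/-- Choice function for the short factors: `u t v = F t ((S t).image v)`. [folklore] -/
theorem exists_F (ho2 : ∀ t v v', (S t).image v = (S t).image v' → u t v = u t v') :
    ∃ F : Fin N → Finset (Fin 5) → ℂ, ∀ t v, u t v = F t ((S t).image v) := by
  classical
  refine ⟨fun t A => if h : ∃ v : Fin 5 → Fin 5, (S t).image v = A then u t h.choose else 0,
    fun t v => ?_⟩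
  have h : ∃ v' : Fin 5 → Fin 5, (S t).image v' = (S t).image v := ⟨v, rfl⟩
  simp only [dif_pos h]
  exact ho2 t v h.choose h.choose_spec.symm

/-- Choice function for the long factors: `w t v = G t ((S t)ᶜ.image v)`. [folklore] -/
theorem exists_G (ho4 : ∀ t v v', ((S t)ᶜ).image v = ((S t)ᶜ).image v' → w t v = w t v') :
    ∃ G : Fin N → Finset (Fin 5) → ℂ, ∀ t v, w t v = G t (((S t)ᶜ).image v) := by
  classical
  refine ⟨fun t B => if h : ∃ v : Fin 5 → Fin 5, ((S t)ᶜ).image v = B then w t h.choose else 0,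
    fun t v => ?_⟩
  have h : ∃ v' : Fin 5 → Fin 5, ((S t)ᶜ).image v' = ((S t)ᶜ).image v := ⟨v, rfl⟩
  simp only [dif_pos h]
  exact ho4 t v h.choose h.choose_spec.symm

/-- Collapsing the letter index `1` to `0` does not change `ω`-images when `ω 0 = ω 1`. [folklore] -/
theorem image_collapse (ω : Fin 5 → Fin 5) (hω : ω 0 = ω 1) (Q : Finset (Fin 5)) :
    Q.image ω = (Q.image (fun j : Fin 5 => if j = 1 then 0 else j)).image ω := by
  rw [Finset.image_image]
  congr 1
  funext j
  simp only [Function.comp]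
  by_cases hj : j = 1
  · rw [if_pos hj, hj, hω]
  · rw [if_neg hj]

/-- **Canonical regrouping.**  The exactness sum at the word `ω ∘ ρ` (collision at the slots `i₀, i₁` with
`ρ i₀ = 0`, `ρ i₁ = 1`) equals the sum over a list `L` of entries `(S₀, Q_A, Q_B)` of the canonical fibers
`∑_{t ∈ T, S t = S₀} F t (Q_A.image ω) * G t (Q_B.image ω)`, provided the first components are duplicate-free
and contain every slot set separating `i₀` from `i₁`, and `Q_A`, `Q_B` have the same collapsed letter indices as
`ρ(S₀)`, `ρ(S₀ᶜ)` (all three side conditions are decidable on concrete data). [folklore] -/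
theorem regroup_canon (ho1 : ∀ t v, ((S t).image v).card < (S t).card → u t v = 0)
    (ho3 : ∀ t v, (((S t)ᶜ).image v).card < ((S t)ᶜ).card → w t v = 0)
    (F G : Fin N → Finset (Fin 5) → ℂ) (hF : ∀ t v, u t v = F t ((S t).image v))
    (hG : ∀ t v, w t v = G t (((S t)ᶜ).image v))
    (ω : Fin 5 → Fin 5) (hω : ω 0 = ω 1) (ρ : Fin 5 → Fin 5) (i₀ i₁ : Fin 5) (hi : i₀ ≠ i₁)
    (hρ0 : ρ i₀ = 0) (hρ1 : ρ i₁ = 1)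
    (L : List (Finset (Fin 5) × (Finset (Fin 5) × Finset (Fin 5)))) (hnd : (L.map Prod.fst).Nodup)
    (hcov : ∀ S₀ : Finset (Fin 5), ((i₀ ∈ S₀ ∧ i₁ ∉ S₀) ∨ (i₀ ∉ S₀ ∧ i₁ ∈ S₀)) → S₀ ∈ L.map Prod.fst)
    (hcan : ∀ e ∈ L,
      (e.1.image ρ).image (fun j : Fin 5 => if j = 1 then 0 else j)
          = e.2.1.image (fun j : Fin 5 => if j = 1 then 0 else j) ∧
        ((e.1)ᶜ.image ρ).image (fun j : Fin 5 => if j = 1 then 0 else j)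
          = e.2.2.image (fun j : Fin 5 => if j = 1 then 0 else j)) :
    ∑ t ∈ T, u t (ω ∘ ρ) * w t (ω ∘ ρ)
      = (L.map (fun e => ∑ t ∈ T.filter (fun t => S t = e.1),
          F t (e.2.1.image ω) * G t (e.2.2.image ω))).sum := by
  have hcol : (ω ∘ ρ) i₀ = (ω ∘ ρ) i₁ := by
    simp only [Function.comp, hρ0, hρ1, hω]
  rw [sum_eq_sum_map_fiber T S u w ho1 ho3 (ω ∘ ρ) hi hcol (L.map Prod.fst) hnd hcov, List.map_map]
  congr 1
  refine List.map_congr_left fun e he => ?_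
  obtain ⟨hA, hB⟩ := hcan e he
  simp only [Function.comp]
  refine Finset.sum_congr rfl fun t ht => ?_
  have hS : S t = e.1 := (Finset.mem_filter.mp ht).2
  have h1 : (S t).image (ω ∘ ρ) = e.2.1.image ω := by
    rw [hS, ← Finset.image_image, image_collapse ω hω, hA, ← image_collapse ω hω]
  have h2 : ((S t)ᶜ).image (ω ∘ ρ) = e.2.2.image ω := by
    rw [hS, ← Finset.image_image, image_collapse ω hω, hB, ← image_collapse ω hω]
  rw [hF t, hG t, h1, h2]

/-- A nonzero canonical fiber carries a term of `T` on its slot set. [folklore] -/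
theorem occupied_of_fiber_ne_zero (F G : Fin N → Finset (Fin 5) → ℂ) (S₀ : Finset (Fin 5)) (A B : Finset (Fin 5))
    (h : ∑ t ∈ T.filter (fun t => S t = S₀), F t A * G t B ≠ 0) : ∃ t ∈ T, S t = S₀ := by
  obtain ⟨t, ht, -⟩ := Finset.exists_ne_zero_of_sum_ne_zero h
  exact ⟨t, (Finset.mem_filter.mp ht).1, (Finset.mem_filter.mp ht).2⟩

/-- Exactness at a word with a collision: the sum over `T` vanishes. [folklore] -/
theorem sum_eq_zero_of_collision
    (hid : ∀ v : Fin 5 → Fin 5, (∑ t ∈ T, u t v * w t v) = if Function.Injective v then 1 else 0)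
    (v : Fin 5 → Fin 5) {p q : Fin 5} (hpq : p ≠ q) (hv : v p = v q) :
    ∑ t ∈ T, u t v * w t v = 0 := by
  rw [hid v, if_neg]
  exact fun hinj => hpq (hinj hv)

/-- **Canonical regrouping, packaged.**  With `Ψ ω (S₀, Q_A, Q_B) = ∑_{t ∈ T, S t = S₀} F t (Q_A.image ω) * G t (Q_B.image ω)`
and exactness, the equation at the collision word `ω ∘ ρ` reads `(L.map (Ψ ω)).sum = 0`. [folklore] -/
theorem canon_equation (ho1 : ∀ t v, ((S t).image v).card < (S t).card → u t v = 0)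
    (ho3 : ∀ t v, (((S t)ᶜ).image v).card < ((S t)ᶜ).card → w t v = 0)
    (hid : ∀ v : Fin 5 → Fin 5, (∑ t ∈ T, u t v * w t v) = if Function.Injective v then 1 else 0)
    (F G : Fin N → Finset (Fin 5) → ℂ) (hF : ∀ t v, u t v = F t ((S t).image v))
    (hG : ∀ t v, w t v = G t (((S t)ᶜ).image v))
    (Ψ : (Fin 5 → Fin 5) → Finset (Fin 5) × (Finset (Fin 5) × Finset (Fin 5)) → ℂ)
    (hΨ : ∀ ω' S₀ A B, Ψ ω' (S₀, A, B)
      = ∑ t ∈ T.filter (fun t => S t = S₀), F t (A.image ω') * G t (B.image ω'))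
    (ω : Fin 5 → Fin 5) (hω : ω 0 = ω 1) (ρ : Fin 5 → Fin 5) (i₀ i₁ : Fin 5) (hi : i₀ ≠ i₁)
    (hρ0 : ρ i₀ = 0) (hρ1 : ρ i₁ = 1)
    (L : List (Finset (Fin 5) × (Finset (Fin 5) × Finset (Fin 5)))) (hnd : (L.map Prod.fst).Nodup)
    (hcov : ∀ S₀ : Finset (Fin 5), ((i₀ ∈ S₀ ∧ i₁ ∉ S₀) ∨ (i₀ ∉ S₀ ∧ i₁ ∈ S₀)) → S₀ ∈ L.map Prod.fst)
    (hcan : ∀ e ∈ L,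
      (e.1.image ρ).image (fun j : Fin 5 => if j = 1 then 0 else j)
          = e.2.1.image (fun j : Fin 5 => if j = 1 then 0 else j) ∧
        ((e.1)ᶜ.image ρ).image (fun j : Fin 5 => if j = 1 then 0 else j)
          = e.2.2.image (fun j : Fin 5 => if j = 1 then 0 else j)) :
    (L.map (Ψ ω)).sum = 0 := by
  have hcol : (ω ∘ ρ) i₀ = (ω ∘ ρ) i₁ := by
    simp only [Function.comp, hρ0, hρ1, hω]
  have h := regroup_canon T S u w ho1 ho3 F G hF hG ω hω ρ i₀ i₁ hi hρ0 hρ1 L hnd hcov hcan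
  rw [sum_eq_zero_of_collision T u w hid (ω ∘ ρ) hi hcol] at h
  rw [h]
  congr 1
  refine List.map_congr_left fun e _ => ?_
  obtain ⟨S₀, A, B⟩ := e
  exact hΨ ω S₀ A B

end LaplaceFiveOnShell

end Summit.ValiantsHypothesis.ValiantsHypothesis.Theorems.RigidityForcesSymmetryRankRigidMinimalRepr
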